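import Summits.CriticalPhenomena.Ising3D.ExclusionSentencesAlg

/-!
# Rule R3 for family `ALG`: a complete exception list settles every sub-interval (no re-scan)

SCOPE.md §3 (pub-ising3x, recog-1).  `ExclusionSentencesAlg.lean` certifies, per certified interval
`[a, b]` and degree `d`, that every member of `algFamily d H` in `[a, b]` is a root of a LISTED integer
polynomial (`algExcluded_sound`; the list is cumulative over the degrees).  Phase 1 certifies a ladder
of nested intervals for the same datum; the `LIN` and `TRG` tables already have refinement lemmas
(`not_mem_linFamily_of_refine`, gen 5; `trgFull_listed_of_refine`, gen 6) so that the second rung costs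
no table re-scan.  This file is the `ALG` analogue:

* `algRefine a' b' depth ex ex' : Bool` — every polynomial of `ex` is either kept in `ex'` or has no
  root on `[a', b']` by the kernel's own bisection sign test `exclTest` (`ExclusionSentencesAlgCore`),
  on the scaled integer interval `[a'.num · b'.den, b'.num · a'.den] / (a'.den · b'.den)`; `0 ≤ a'`.
* **`alg_listed_of_refine`** (generic in the covered set `S`): coverage of `S ∩ [a, b]` by `ex` +
  `[a', b'] ⊆ [a, b]` + `algRefine a' b' depth ex ex' = true` ⇒ coverage of `S ∩ [a', b']` by `ex'`;
  `alg_listed_of_algExcluded_refine` (from an `algExcluded` theorem), `not_mem_algFamily_of_refine`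
  (`ex' = []`), bridges `sigma/eps_alg_covered_of_isingEnclosure_refine`.
* Synthetic instance (golden ratio, no 3D digit): on `[0.6180, 0.6181]` the complete list `goldenEx`
  (34 polynomials: 33 rationals of height `≤ 1024` and `X² + X − 1`; degrees 1–4 at the table heights
  `1024/64/12/6`), refined to `[0.61803, 0.61804]`: `goldenSubEx` = the five polynomials
  `377X − 233, 610X − 377, 843X − 521, 987X − 610, X² + X − 1` — exactly the list the direct scan of
  the narrow window gives (gen 4's example; re-decided here: `golden_sub_direct_d1/d2`).

Twin: `HOME/pub-ising3x-recog-1/lean/tools/alg_refine.py` (imports the landed `alg_exceptions.py`;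
`ex'` := the polynomials `exclTest` does not discharge, each classified member / near-miss by exact
Sturm).  `decide +kernel` only; no `native_decide`; no new axioms.  Framing: lottery ticket; floor =
tightest certified 3D Ising CFT bounds; no exact-solution claim without a proof.
-/

namespace Summit.CriticalPhenomena.Ising3D

open Literature.MathematicalPhysics.QuantumFieldTheory.ConformalBootstrap3D

/-! ### The refinement checker and its soundness -/

/-- `algRefine a' b' depth ex ex'`: `0 ≤ a'` and every polynomial `q ∈ ex` is listed in `ex'` or is
root-free on `[a', b']` by `exclTest q depth` on the scaled integer interval. -/
def algRefine (a' b' : ℚ) (depth : ℕ) (ex ex' : List (List ℤ)) : Bool :=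
  decide (0 ≤ a') &&
    ex.all fun q => decide (q ∈ ex') ||
      exclTest q depth (a'.num * b'.den) (b'.num * a'.den) ((a'.den : ℤ) * b'.den)

/-- **Rule R3 for `ALG` (generic).** If every `x ∈ S ∩ [a, b]` is a root of a polynomial of `ex`,
`[a', b'] ⊆ [a, b]` and `algRefine a' b' depth ex ex' = true`, then every `x ∈ S ∩ [a', b']` is a root
of a polynomial of `ex'`. -/
theorem alg_listed_of_refine {S : Set ℝ} {a b a' b' : ℚ} {ex ex' : List (List ℤ)} {depth : ℕ}
    (hcov : ∀ ⦃x : ℝ⦄, (a : ℝ) ≤ x ∧ x ≤ b → x ∈ S → ∃ q ∈ ex, evalL q x = 0) (ha : a ≤ a')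
    (hb : b' ≤ b) (h : algRefine a' b' depth ex ex' = true) {x : ℝ} (hx : (a' : ℝ) ≤ x ∧ x ≤ b')
    (hmem : x ∈ S) : ∃ q ∈ ex', evalL q x = 0 := by
  simp only [algRefine, Bool.and_eq_true, decide_eq_true_eq, List.all_eq_true, Bool.or_eq_true] at h
  obtain ⟨ha', hall⟩ := h
  have hx' : (a : ℝ) ≤ x ∧ x ≤ b :=
    ⟨le_trans (by exact_mod_cast ha) hx.1, le_trans hx.2 (by exact_mod_cast hb)⟩
  obtain ⟨q, hq, hq0⟩ := hcov hx' hmem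
  rcases hall q hq with hq' | hexcl
  · exact ⟨q, hq', hq0⟩
  · exfalso
    have hM : (0 : ℤ) < (a'.den : ℤ) * b'.den := by
      exact_mod_cast Nat.mul_pos a'.den_pos b'.den_pos
    have hLO : (0 : ℤ) ≤ a'.num * b'.den :=
      mul_nonneg (Rat.num_nonneg.mpr ha') (Int.natCast_nonneg _)
    have hprod : (0 : ℝ) ≤ (a'.den : ℝ) * b'.den := by positivity
    have hlo : ((a'.num * b'.den : ℤ) : ℝ) ≤ x * (((a'.den : ℤ) * b'.den : ℤ) : ℝ) := by
      push_cast; rw [← ratCast_mul_den a']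
      calc (a' : ℝ) * a'.den * b'.den = a' * (a'.den * b'.den) := by ring
        _ ≤ x * (a'.den * b'.den) := mul_le_mul_of_nonneg_right hx.1 hprod
    have hhi : x * (((a'.den : ℤ) * b'.den : ℤ) : ℝ) ≤ ((b'.num * a'.den : ℤ) : ℝ) := by
      push_cast; rw [← ratCast_mul_den b']
      calc x * ((a'.den : ℝ) * b'.den) ≤ b' * (a'.den * b'.den) :=
            mul_le_mul_of_nonneg_right hx.2 hprod
        _ = (b' : ℝ) * b'.den * a'.den := by ring
    exact exclTest_sound q depth hexcl hLO hM hlo hhi hq0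

/-- Rule R3 from an `algExcluded` theorem of the wide interval. -/
theorem alg_listed_of_algExcluded_refine {d H : ℕ} {a b a' b' : ℚ} {depth fuel depth' : ℕ}
    {ex ex' : List (List ℤ)} (h : algExcluded d H a b depth fuel ex = true) (ha : a ≤ a')
    (hb : b' ≤ b) (hr : algRefine a' b' depth' ex ex' = true) {x : ℝ} (hx : (a' : ℝ) ≤ x ∧ x ≤ b')
    (hmem : x ∈ algFamily d H) : ∃ q ∈ ex', evalL q x = 0 :=
  alg_listed_of_refine (S := algFamily d H) (fun _ hx' hm => algExcluded_sound h hx' hm) ha hb hr hx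
    hmem

/-- Empty refined list: no member of `algFamily d H` in the sub-interval. -/
theorem not_mem_algFamily_of_refine {d H : ℕ} {a b a' b' : ℚ} {depth fuel depth' : ℕ}
    {ex : List (List ℤ)} (h : algExcluded d H a b depth fuel ex = true) (ha : a ≤ a') (hb : b' ≤ b)
    (hr : algRefine a' b' depth' ex [] = true) {x : ℝ} (hx : (a' : ℝ) ≤ x ∧ x ≤ b') :
    x ∉ algFamily d H := fun hmem => by
  obtain ⟨q, hq, _⟩ := alg_listed_of_algExcluded_refine h ha hb hr hx hmem
  simp at hq

/-! ### Bridges from the floor's statement (refined rung) -/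

/-- **ALG sentence for `Δ_σ` on a refined rung.** Under `IsingEnclosure W R` with the
`Δ_σ`-projection of `R` inside the SUB-interval `[a', b']` of a wide interval `[a, b]` carrying
`algExcluded d H a b … ex = true`, and `algRefine a' b' depth' ex ex' = true`: an algebraic `Δ_σ` of
degree `d`, height `≤ H` is a root of a polynomial of the refined list `ex'`. -/
theorem sigma_alg_covered_of_isingEnclosure_refine {W R : Set (ℝ × ℝ)} (h : IsingEnclosure W R)
    {a b a' b' : ℚ} (hR : ∀ q ∈ R, (a' : ℝ) ≤ q.1 ∧ q.1 ≤ b') {d H depth fuel depth' : ℕ}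
    {ex ex' : List (List ℤ)} (hx : algExcluded d H a b depth fuel ex = true) (ha : a ≤ a')
    (hb : b' ≤ b) (hr : algRefine a' b' depth' ex ex' = true) (D : SigmaEpsilonData)
    (hD : D.SatisfiesBootstrapAxioms) (hW : (D.Δσ, D.Δε) ∈ W) (hmem : D.Δσ ∈ algFamily d H) :
    ∃ q ∈ ex', evalL q D.Δσ = 0 :=
  alg_listed_of_algExcluded_refine hx ha hb hr (hR _ (h D hD hW)) hmem

/-- **ALG sentence for `Δ_ε` on a refined rung.** -/
theorem eps_alg_covered_of_isingEnclosure_refine {W R : Set (ℝ × ℝ)} (h : IsingEnclosure W R)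
    {a b a' b' : ℚ} (hR : ∀ q ∈ R, (a' : ℝ) ≤ q.2 ∧ q.2 ≤ b') {d H depth fuel depth' : ℕ}
    {ex ex' : List (List ℤ)} (hx : algExcluded d H a b depth fuel ex = true) (ha : a ≤ a')
    (hb : b' ≤ b) (hr : algRefine a' b' depth' ex ex' = true) (D : SigmaEpsilonData)
    (hD : D.SatisfiesBootstrapAxioms) (hW : (D.Δσ, D.Δε) ∈ W) (hmem : D.Δε ∈ algFamily d H) :
    ∃ q ∈ ex', evalL q D.Δε = 0 :=
  alg_listed_of_algExcluded_refine hx ha hb hr (hR _ (h D hD hW)) hmem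

/-! ### Synthetic instance: the golden-ratio windows (no 3D digit) -/

/-- Complete `ALG` exception list of the WIDE window `[0.6180, 0.6181]`, cumulative over degrees
`1…4` at the table heights `1024, 64, 12, 6` (twin `alg_exceptions.py`): the 33 rationals of height
`≤ 1024` inside (as `den·X − num`) and `X² + X − 1` (root `(√5 − 1)/2`). -/
def goldenEx : List (List ℤ) :=
  [[-89, 144], [-123, 199], [-144, 233], [-199, 322], [-212, 343], [-233, 377], [-254, 411],
    [-301, 487], [-309, 500], [-322, 521], [-335, 542], [-343, 555], [-377, 610], [-390, 631],
    [-403, 652], [-411, 665], [-453, 733], [-458, 741], [-479, 775], [-487, 788], [-500, 809],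
    [-513, 830], [-521, 843], [-526, 851], [-542, 877], [-547, 885], [-555, 898], [-563, 911],
    [-568, 919], [-581, 940], [-589, 953], [-610, 987], [-631, 1021], [-1, 1, 1]]

/-- Wide window, degree 1, height `≤ 1024`. -/
theorem golden_alg_d1 : algExcluded 1 1024 (309 / 500) (6181 / 10000) 6 6 goldenEx = true := by
  decide +kernel

/-- Wide window, degree 2, height `≤ 64`. -/
theorem golden_alg_d2 : algExcluded 2 64 (309 / 500) (6181 / 10000) 6 6 goldenEx = true := by
  decide +kernel

/-- Wide window, degree 3, height `≤ 12`. -/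
theorem golden_alg_d3 : algExcluded 3 12 (309 / 500) (6181 / 10000) 6 6 goldenEx = true := by
  decide +kernel

/-- Wide window, degree 4, height `≤ 6`. -/
theorem golden_alg_d4 : algExcluded 4 6 (309 / 500) (6181 / 10000) 6 6 goldenEx = true := by
  decide +kernel

/-- The refined list on the NARROW window `[0.61803, 0.61804]`: the five polynomials the bisection sign
test (depth 8) does not discharge there — `377X − 233`, `610X − 377`, `843X − 521`, `987X − 610`,
`X² + X − 1` (all genuine members; twin `alg_refine.py`). -/
def goldenSubEx : List (List ℤ) :=
  [[-233, 377], [-377, 610], [-521, 843], [-610, 987], [-1, 1, 1]]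

/-- Rule R3 check: every polynomial of `goldenEx` is kept in `goldenSubEx` or is root-free on the narrow
window. -/
theorem golden_refine :
    algRefine (61803 / 100000) (61804 / 100000) 8 goldenEx goldenSubEx = true := by
  decide +kernel

/-- Narrow window by refinement, degree 2: a quadratic irrational of height `≤ 64` (or a rational of
height `≤ 1024`, degree 1 — `golden_sub_alg_d1_refined`) in `[0.61803, 0.61804]` is a root of one of the
five listed polynomials; no table re-scan. -/
theorem golden_sub_alg_d2_refined {x : ℝ} (hx : ((61803 / 100000 : ℚ) : ℝ) ≤ x ∧
      x ≤ ((61804 / 100000 : ℚ) : ℝ)) (hmem : x ∈ algFamily 2 64) :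
    ∃ q ∈ goldenSubEx, evalL q x = 0 :=
  alg_listed_of_algExcluded_refine golden_alg_d2 (by norm_num) (by norm_num) golden_refine hx hmem

/-- The same for degree 1 (rationals of height `≤ 1024`). -/
theorem golden_sub_alg_d1_refined {x : ℝ} (hx : ((61803 / 100000 : ℚ) : ℝ) ≤ x ∧
      x ≤ ((61804 / 100000 : ℚ) : ℝ)) (hmem : x ∈ algFamily 1 1024) :
    ∃ q ∈ goldenSubEx, evalL q x = 0 :=
  alg_listed_of_algExcluded_refine golden_alg_d1 (by norm_num) (by norm_num) golden_refine hx hmem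

/-- Consistency with the direct scan of the narrow window (gen 4's example list): `goldenSubEx` is a
complete list there for degree 1 … -/
theorem golden_sub_direct_d1 :
    algExcluded 1 1024 (61803 / 100000) (61804 / 100000) 6 6 goldenSubEx = true := by
  decide +kernel

/-- … and for degree 2. -/
theorem golden_sub_direct_d2 :
    algExcluded 2 64 (61803 / 100000) (61804 / 100000) 6 6 goldenSubEx = true := by
  decide +kernel

/-- Non-vacuity of the refinement check: dropping `X² + X − 1` from the refined list fails it (the sign
test cannot discharge a polynomial that vanishes inside the window). -/
theorem golden_refine_minimal :
    algRefine (61803 / 100000) (61804 / 100000) 8 goldenEx (goldenSubEx.take 4) = false := by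
  decide +kernel

end Summit.CriticalPhenomena.Ising3D
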